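import Summits.BirchSwinnertonDyer.BirchSwinnertonDyer.Theorems.AlignedTransportAtTwoMainConjectureOfRankZeroBSDAtTwoFineRoad
import Summits.BirchSwinnertonDyer.BirchSwinnertonDyer.Theorems.AlignedTransportAtTwoMainConjectureOfRankZeroBSDAtTwoSeed
import HarnessLib

/-!
# Route `AlignedTransportAtTwo`, crux C2 `MainConjectureOfRankZeroBSDAtTwo` (stmt-BirchSwinnertonDyer-22298):
# the `μ`-part road at `𝔭 = (2)` through Coates–Sujatha (A) — §5, THE CRUX-LEVEL COMPOSITIONS

HONEST FRAMING (cell `bsd-f1-sign2`, lead prover seat `bsd-line-att-p2` gen 2; BSD is NOT proved by any of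
this). THEOREMS ONLY; continuation of `…MainConjectureOfRankZeroBSDAtTwoFineRoad` (§1–§4: the `μ`-bookkeeping
`μ(X) ≤ μ(ker col) + n + μ(G) + μ(X₀)` at `(2)` over displayed Kato-shaped data, statement (A) at `(E,2)` from
Lim 2017 Thm. 3.5 at `2` + classical `μ = 0` of a `2`-power-index subfield of `ℚ(E[4])`). Here:

* `mazurMainConjecture_two_of_bsdp_of_fineRoad` — PER CURVE: PRINT (Kato 17.4 (1)(2) at `2`, Greenberg 4.1,
  period unit, modularity, GZK; as in p583329) + good ordinary at `2` + no rational `2`-torsion + `r_an = 0` +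
  `BSD(W,2)` + analytic `μ₂ = 0` + the DISPLAYED Kato data at `2` (hypothesis `hK`, construction target) +
  statement (A) at `(W,2)` ⟹ `MazurMainConjecture W 2`. A third certificate door (after `TowerGapAtTwo` and
  the `λ`-match), whose non-print inputs are LOCAL at `2` (`hK`) and CLASS-GROUP-theoretic (`hA`).
* `seedMuZeroAtTwo_of_fineRoad` — stub T of line `birth` (the statement `SeedMuZeroAtTwo`, written out) from
  modularity + Lim's fact + (K₂) + (A₂); `mainConjectureOfRankZeroBSDAtTwo_of_fineRoad` — C2 BY NAME from
  PRINT + Lim + (K₂) + (A₂), through p583329's `mainConjectureOfRankZeroBSDAtTwo_of_seedMuZero`.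
  (K₂) = Kato's §17.13 data at good ordinary `2` in fine form, injective Coleman map, NO `2`-power defect in
  the zeta image of the integral lift of `L₂(f, α)` — NOT in print at `𝔭 = (2)` (construction target);
  (A₂) = for every seed a subfield `L ⊆ ℚ(W[4])` of `2`-power index with classical `μ = 0` (the cubic field
  `ℚ(e₁)`; Iwasawa's conjecture — OPEN for `S₃`-cubics, Ferrero–Washington for abelian `L`).
  CONDITIONAL: the item stays open. On this road C2's analytic `μ₂ = 0` binder is USED (`red G ≠ 0` gives
  `μ(G) = 0` for the integral lift `G`), in contrast with road (a) (Greenberg Conj. 1.11 at `2`).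

References: K. Kato, Astérisque 295 (2004), Thm. 17.4, §17.13, Conj. 12.10; M. F. Lim, Asian J. Math. 21
(2017) Thm. 3.5; J. Coates, R. Sujatha, Math. Ann. 331 (2005) §3; R. Greenberg, LNM 1716 (1999) Conj. 1.11,
Thm. 4.1.
-/

set_option linter.dupNamespace false
set_option autoImplicit false

noncomputable section

open scoped Classical

open Literature.NumberTheory.EllipticCurves Literature.NumberTheory.EllipticCurves.Module

namespace Summit.BirchSwinnertonDyer.BirchSwinnertonDyer.Theorems.AlignedTransportAtTwoFineRoad

/-! ## §5 The crux: C2 from PRINT + Kato data at good ordinary `2` (target) + classical `μ = 0` of the seeds'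
cubic fields (open for `S₃`-cubics) — the road on which C2's analytic `μ₂ = 0` binder is LOAD-BEARING -/

section Crux

open CongruenceSubgroup WeierstrassCurve Literature.NumberTheory.EllipticCurves.ModularForms
  Literature.NumberTheory.EllipticCurves.Greenberg1999
  Literature.NumberTheory.EllipticCurves.Rank1Residual
  Literature.NumberTheory.IwasawaTheory
  Summit.BirchSwinnertonDyer.Rank1Residual Summit.BirchSwinnertonDyer.Rank1Residual.X1.MuLambda
  Summit.BirchSwinnertonDyer.Rank1Residual.X5 Summit.BirchSwinnertonDyer.Rank1Residual.F1Sign2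
  Summit.BirchSwinnertonDyer.BirchSwinnertonDyer.Theorems.Rank1ResidualX1Defs
  Summit.BirchSwinnertonDyer.BirchSwinnertonDyer.Theses.AlignedTransportAtTwo

/-- **THE FINE ROAD, PER CURVE (a third certificate door beside `TowerGapAtTwo` and the `λ`-match).**
Let `W/ℚ` be globally minimal, good ordinary at `2`, with no rational point of order `2`, `r_an = 0`,
`BSD(W,2)` known, and with analytic `μ₂ = 0` (`red G ≠ 0` for every even-branch lift `G`). Granted PRINT
(Kato 17.4 (1)(2) at `2`, Greenberg 4.1, the period unit, modularity, GZK — as in p583329), the DISPLAYED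
Kato data at `2` in fine form for every cyclotomic datum of `W` (hypothesis `hK`: a construction target, NOT
print), and Coates–Sujatha's statement (A) at `(W, 2)` (`hA`: `Sel₀(ℚ_∞, W[2^∞])[2]` finite — e.g. from the
classical `μ = 0` of the cubic field of `W`, §4): Mazur's `2`-adic main conjecture for `W`.
[cite: Kato2004Asterisque, Thm. 17.4 (1)(2) (p. 273) and §17.13 (pp. 279–280)] [cite: CoatesSujatha2005, statement (A) (§3)]
[cite: GreenbergLNM1716, Thm. 4.1 (p. 102)] -/
theorem mazurMainConjecture_two_of_bsdp_of_fineRoad (W : WeierstrassCurve ℚ) [W.IsElliptic]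
    [W.IsGloballyMinimal]
    (h17 : ∀ [NeZero (W.conductorNorm ℤ)] (f : CuspForm (Gamma0 (W.conductorNorm ℤ)) 2),
      kato_divisibility_allPrimes W 2 (f := f))
    (hGr : Greenberg1999.thm41_charValue_rankZero_anyPrime)
    (hper : realPeriodRat_eq_unit_mul_plusPeriod_two) (hmod : nonempty_modularParametrizationData)
    (hGZK : rank_eq_analyticRank_of_analyticRank_le_one) (hord : IsOrdinaryAt W 2)
    (ht : ∀ x : ℚ, ¬ HasRationalTwoTorsionX W x) (hr : W.analyticRank = 0) (hbsd : BSDp W 2)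
    (hμan : ∀ ⦃N : ℕ⦄ [NeZero N] (f : CuspForm (Gamma0 N) 2), IsNewformOf W f →
      ∀ G : IwasawaAlgebra 2, IsEvenBranchLiftAtTwo W f G → red G ≠ 0)
    (hK : ∀ (κ : ZpExtension ℚ 2) (γ : Field.absoluteGaloisGroup ℚ), κ.IsCyclotomic →
      κ.IsTopGenerator γ → IsCyclotomicVariable 2 γ →
      ∀ ⦃N : ℕ⦄ [NeZero N] (f : CuspForm (Gamma0 N) 2), IsNewformOf W f →
      ∀ G : IwasawaAlgebra 2, iwasawaToPowerSeries 2 G = padicLFunction f (unitRoot W 2 : ℚ_[2]) →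
      ∀ (D : W.SelmerDualData κ γ) (Yd : W.FineSelmerDualData κ γ),
        ∃ (H P : Type) (_ : AddCommGroup H) (_ : _root_.Module (IwasawaAlgebra 2) H)
          (_ : AddCommGroup P) (_ : _root_.Module (IwasawaAlgebra 2) P)
          (loc : H →ₗ[IwasawaAlgebra 2] P) (toX : P →ₗ[IwasawaAlgebra 2] D.X)
          (π : D.X →ₗ[IwasawaAlgebra 2] Yd.X) (col : P →ₗ[IwasawaAlgebra 2] IwasawaAlgebra 2)
          (z : H) (s : IwasawaAlgebra 2),
          Function.Injective col ∧ (∀ h, toX (loc h) = 0) ∧ Function.Exact toX π ∧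
            s ∉ IwasawaAlgebra.augIdealP 2 ∧ col (loc z) = s * G)
    (hA : ∀ κ : ZpExtension ℚ 2, κ.IsCyclotomic → Set.Finite {s : W.fineSelmerInfty κ | 2 • s = 0}) :
    MazurMainConjecture W 2 := by
  refine AlignedTransportAtTwoSeed.mazurMainConjecture_two_of_bsdp_of_mu_eq_zero W h17 hGr hper hmod
    hGZK hord ht hr hbsd fun κ γ hκ hγ hγ' D _ => ?_
  have hirr : Irr W 2 := AlignedTransportAtTwoSeed.irr_two_of_forall_not_hasRationalTwoTorsionX W ht
  haveI : NeZero (W.conductorNorm ℤ) := ⟨(W.conductorNorm_pos_holds).ne'⟩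
  obtain ⟨Dm⟩ := hmod W
  obtain ⟨G, hG⟩ := exists_iwasawaToPowerSeries_eq_padicLFunction_two hord Dm.isNewformOf hirr
  have hred : red G ≠ 0 := hμan Dm.f Dm.isNewformOf G (Or.inl ⟨hord, hG⟩)
  let Yd : W.FineSelmerDualData κ γ := W.fineSelmerDualData κ hγ
  obtain ⟨H, P, _, _, _, _, loc, toX, π, col, z, s, hcol, h0, hX, hs, hz⟩ :=
    hK κ γ hκ hγ hγ' Dm.f Dm.isNewformOf G hG D Yd
  exact selmerDual_mu_eq_zero_of_fineSkeleton_two W hγ D Yd (hA κ hκ) hred loc toX π col hcol h0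
    hX hs hz

/-- **C2's residue `SeedMuZeroAtTwo` (line `birth`, stub T) from the fine road.** Modularity (PRINT, `hmod`),
Lim 2017 Thm. 3.5 at `2` (PRINT, `hLim`) and two displayed class-wide inputs on the seed cell — (K₂) Kato's
§17.13 data at good ordinary `2` in fine form with injective Coleman map and no `2`-power defect in the zeta
image of the integral lift of `L₂(f, α)` (a construction TARGET; not in print at `𝔭 = (2)`), and (A₂) for
every seed a subfield `L ⊆ ℚ(W[4])` of `2`-power index whose cyclotomic `ℤ₂`-extensions have classical
`μ = 0` (the cubic field `ℚ(e₁)`; Iwasawa's conjecture, OPEN for `S₃`-cubics, per-field certifiable by the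
doors of `IwasawaTheory/ClassicalMuInvariant`) — give `μ₂(X(W/ℚ_∞)) = 0` for every seed-cell curve and every
cyclotomic dual datum. The seed-cell binders `¬ HasCM`, `Δ ∉ ℚ²`, `r_an = 0`, `BSD(W,2)` are passed along
unused; the analytic `μ₂ = 0` binder IS used. [cite: Kato2004Asterisque, §17.13 (pp. 279–280)]
[cite: Lim2017FineSelmer, §3 Thm. 3.5 and Lemma 3.2] [cite: CoatesSujatha2005, statement (A) and Thm. 3.4] -/
theorem seedMuZeroAtTwo_of_fineRoad (hmod : nonempty_modularParametrizationData)
    (hLim : Lim2017.thm35_at_two_fineSelmerDual_moduleFinite_of_classicalMuVanishes_of_le_divisionField_four)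
    (hK2 : ∀ (W : WeierstrassCurve ℚ) [W.IsElliptic] [W.IsGloballyMinimal], IsOrdinaryAt W 2 →
      (∀ x : ℚ, ¬ HasRationalTwoTorsionX W x) →
      ∀ (κ : ZpExtension ℚ 2) (γ : Field.absoluteGaloisGroup ℚ), κ.IsCyclotomic →
      κ.IsTopGenerator γ → IsCyclotomicVariable 2 γ →
      ∀ ⦃N : ℕ⦄ [NeZero N] (f : CuspForm (Gamma0 N) 2), IsNewformOf W f →
      ∀ G : IwasawaAlgebra 2, iwasawaToPowerSeries 2 G = padicLFunction f (unitRoot W 2 : ℚ_[2]) →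
      ∀ (D : W.SelmerDualData κ γ) (Yd : W.FineSelmerDualData κ γ),
        ∃ (H P : Type) (_ : AddCommGroup H) (_ : _root_.Module (IwasawaAlgebra 2) H)
          (_ : AddCommGroup P) (_ : _root_.Module (IwasawaAlgebra 2) P)
          (loc : H →ₗ[IwasawaAlgebra 2] P) (toX : P →ₗ[IwasawaAlgebra 2] D.X)
          (π : D.X →ₗ[IwasawaAlgebra 2] Yd.X) (col : P →ₗ[IwasawaAlgebra 2] IwasawaAlgebra 2)
          (z : H) (s : IwasawaAlgebra 2),
          Function.Injective col ∧ (∀ h, toX (loc h) = 0) ∧ Function.Exact toX π ∧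
            s ∉ IwasawaAlgebra.augIdealP 2 ∧ col (loc z) = s * G)
    (hA2 : ∀ (W : WeierstrassCurve ℚ) [W.IsElliptic] [W.IsGloballyMinimal], ¬ W.HasCM →
      IsOrdinaryAt W 2 → (∀ x : ℚ, ¬ HasRationalTwoTorsionX W x) → ¬ IsSquare W.Δ →
      W.analyticRank = 0 → BSDp W 2 →
      ∃ L : IntermediateField ℚ (AlgebraicClosure ℚ), L ≤ W.divisionField 4 ∧
        (∃ k : ℕ, Module.finrank ℚ (W.divisionField 4) = 2 ^ k * Module.finrank ℚ L) ∧
        ∀ κL : ZpExtension L 2, κL.IsCyclotomic → ClassicalMuVanishes κL) :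
    ∀ (W : WeierstrassCurve ℚ) [W.IsElliptic] [W.IsGloballyMinimal], ¬ W.HasCM →
      IsOrdinaryAt W 2 → (∀ x : ℚ, ¬ HasRationalTwoTorsionX W x) → ¬ IsSquare W.Δ →
      W.analyticRank = 0 →
      (∀ ⦃N : ℕ⦄ [NeZero N] (f : CuspForm (Gamma0 N) 2), IsNewformOf W f →
        ∀ G : IwasawaAlgebra 2, IsEvenBranchLiftAtTwo W f G → red G ≠ 0) →
      BSDp W 2 →
      ∀ (κ : ZpExtension ℚ 2) (γ : Field.absoluteGaloisGroup ℚ), κ.IsCyclotomic →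
        κ.IsTopGenerator γ → IsCyclotomicVariable 2 γ →
        ∀ D : W.SelmerDualData κ γ, D.IsTorsion → D.mu = 0 := by
  intro W _ _ hcm hord ht hsq hr hμan hbsd κ γ hκ hγ hγ' D _
  have hirr : Irr W 2 := AlignedTransportAtTwoSeed.irr_two_of_forall_not_hasRationalTwoTorsionX W ht
  haveI : NeZero (W.conductorNorm ℤ) := ⟨(W.conductorNorm_pos_holds).ne'⟩
  obtain ⟨Dm⟩ := hmod W
  obtain ⟨G, hG⟩ := exists_iwasawaToPowerSeries_eq_padicLFunction_two hord Dm.isNewformOf hirr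
  have hred : red G ≠ 0 := hμan Dm.f Dm.isNewformOf G (Or.inl ⟨hord, hG⟩)
  let Yd : W.FineSelmerDualData κ γ := W.fineSelmerDualData κ hγ
  obtain ⟨H, P, _, _, _, _, loc, toX, π, col, z, s, hcol, h0, hX, hs, hz⟩ :=
    hK2 W hord ht κ γ hκ hγ hγ' Dm.f Dm.isNewformOf G hG D Yd
  obtain ⟨L, hL, hidx, hμL⟩ := hA2 W hcm hord ht hsq hr hbsd
  have hA := finite_fineSelmer_twoTorsion_of_classicalMu W hLim L hL hidx hμL κ hκ
  exact selmerDual_mu_eq_zero_of_fineSkeleton_two W hγ D Yd hA hred loc toX π col hcol h0 hX hs hz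

/-- **C2 BY NAME on the fine road.** PRINT {Kato 17.4 (1)(2) at `2` (`h17`), Greenberg 4.1 (`hGr`), the
period unit at `2` (`hper`), modularity (`hmod`), GZK (`hGZK`), Lim 2017 Thm. 3.5 at `2` (`hLim`)} + the two
displayed class-wide inputs (K₂) (Kato data at good ordinary `2`, construction target) and (A₂) (classical
`μ = 0` for a `2`-power-index subfield of `ℚ(W′[4])` of every seed — Iwasawa's conjecture for the seeds'
`S₃` cubic fields, OPEN) ⟹ `MainConjectureOfRankZeroBSDAtTwo`. CONDITIONAL: the crux item
stmt-BirchSwinnertonDyer-22298 stays open; compare `AlignedTransportAtTwoSeed.mainConjectureOfRankZeroBSDAtTwo_of_greenbergMuConjectureIrreducible`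
(road (a): Greenberg's Conj. 1.11 at `2`), of which this is road (b): Kato at `(2)` + Coates–Sujatha (A).
[cite: Kato2004Asterisque, Thm. 17.4 (1)(2) (p. 273) and §17.13 (pp. 279–280)] [cite: Lim2017FineSelmer, §3 Thm. 3.5 and Lemma 3.2]
[cite: GreenbergLNM1716, Thm. 4.1 (p. 102) and Conj. 1.11 (p. 58)] -/
theorem mainConjectureOfRankZeroBSDAtTwo_of_fineRoad
    (h17 : ∀ (V : WeierstrassCurve ℚ) [V.IsElliptic] [V.IsGloballyMinimal] [NeZero (V.conductorNorm ℤ)]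
      (f : CuspForm (Gamma0 (V.conductorNorm ℤ)) 2), kato_divisibility_allPrimes V 2 (f := f))
    (hGr : Greenberg1999.thm41_charValue_rankZero_anyPrime)
    (hper : realPeriodRat_eq_unit_mul_plusPeriod_two) (hmod : nonempty_modularParametrizationData)
    (hGZK : rank_eq_analyticRank_of_analyticRank_le_one)
    (hLim : Lim2017.thm35_at_two_fineSelmerDual_moduleFinite_of_classicalMuVanishes_of_le_divisionField_four)
    (hK2 : ∀ (W : WeierstrassCurve ℚ) [W.IsElliptic] [W.IsGloballyMinimal], IsOrdinaryAt W 2 →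
      (∀ x : ℚ, ¬ HasRationalTwoTorsionX W x) →
      ∀ (κ : ZpExtension ℚ 2) (γ : Field.absoluteGaloisGroup ℚ), κ.IsCyclotomic →
      κ.IsTopGenerator γ → IsCyclotomicVariable 2 γ →
      ∀ ⦃N : ℕ⦄ [NeZero N] (f : CuspForm (Gamma0 N) 2), IsNewformOf W f →
      ∀ G : IwasawaAlgebra 2, iwasawaToPowerSeries 2 G = padicLFunction f (unitRoot W 2 : ℚ_[2]) →
      ∀ (D : W.SelmerDualData κ γ) (Yd : W.FineSelmerDualData κ γ),
        ∃ (H P : Type) (_ : AddCommGroup H) (_ : _root_.Module (IwasawaAlgebra 2) H)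
          (_ : AddCommGroup P) (_ : _root_.Module (IwasawaAlgebra 2) P)
          (loc : H →ₗ[IwasawaAlgebra 2] P) (toX : P →ₗ[IwasawaAlgebra 2] D.X)
          (π : D.X →ₗ[IwasawaAlgebra 2] Yd.X) (col : P →ₗ[IwasawaAlgebra 2] IwasawaAlgebra 2)
          (z : H) (s : IwasawaAlgebra 2),
          Function.Injective col ∧ (∀ h, toX (loc h) = 0) ∧ Function.Exact toX π ∧
            s ∉ IwasawaAlgebra.augIdealP 2 ∧ col (loc z) = s * G)
    (hA2 : ∀ (W : WeierstrassCurve ℚ) [W.IsElliptic] [W.IsGloballyMinimal], ¬ W.HasCM →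
      IsOrdinaryAt W 2 → (∀ x : ℚ, ¬ HasRationalTwoTorsionX W x) → ¬ IsSquare W.Δ →
      W.analyticRank = 0 → BSDp W 2 →
      ∃ L : IntermediateField ℚ (AlgebraicClosure ℚ), L ≤ W.divisionField 4 ∧
        (∃ k : ℕ, Module.finrank ℚ (W.divisionField 4) = 2 ^ k * Module.finrank ℚ L) ∧
        ∀ κL : ZpExtension L 2, κL.IsCyclotomic → ClassicalMuVanishes κL) :
    MainConjectureOfRankZeroBSDAtTwo :=
  AlignedTransportAtTwoSeed.mainConjectureOfRankZeroBSDAtTwo_of_seedMuZero h17 hGr hper hmod hGZK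
    (seedMuZeroAtTwo_of_fineRoad hmod hLim hK2 hA2)

end Crux

end Summit.BirchSwinnertonDyer.BirchSwinnertonDyer.Theorems.AlignedTransportAtTwoFineRoad

end
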